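import Mathlib
import Summits.ValiantsHypothesis.ValiantsHypothesis.Theorems.BarrierLeverPartitionMinorsHitByVPHiddenStatesSecondShellCells

/-!
# Route BarrierLever — item `PartitionMinorsHitByVP` (stmt-ValiantsHypothesis-19717), line `hidden-states`:
# ★★ THE FIRST SHELL OF EVERY BALL `B_t(h)` — all `h`, not only the half `h = 2t+1`

Helper file (`--supports stmt-ValiantsHypothesis-19717`; cell valiant-natproofs, 𝒟-side door (c), registered line
`Cruxes/PartitionMinorsHitByVP/Lines/hidden_states.lean` v8; prover seat val-np-p6 gen 17).  Closes NO item.  Definitions: the transported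
swap table with inert blocks of UNEQUAL sizes (`coreTable'`, `swapTable'`, transparent).

g16's inert dual-vector criterion (`…PathTableInert.det_ne_zero_of_dual_inert`) allows ANY finite inert type `ι₂` and ANY forced-present
part `Z ⊆ ι₂`; g16's cells used it only with `|Z| = |ι₂ ∖ Z|` (the half `h = 2t+1`).  Here the four-part transport has sizes
`(k+1, k, j, j')` = `(|C∖A|, |A∖C|, |A∩C|, |(A∪C)ᶜ|)` with `j'` free, so:
* `exists_equiv_four'` — the transport; `swapTable'_det_ne_zero` — the first-shell certificate with the transport exposed;
  `swapTable'_offdiag` — off-diagonal entries live on the rows `C ∖ A`;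
* ★★ `exists_table_firstShell_anyH` — for EVERY `h, t` and all `A, C ⊆ Fin h` with `|A| = t`, `|C| = t+1`, `A ⊄ C`, every injective row
  family in `B_t(h) ∖ {A} ∪ {C}` with columns covering `B_t(h)` is served by a table (`r = |B_t(h)| = Σ_{i≤t} C(h,i)`; at `h = 20` the
  values `t = 10..14` lie in the registered node's first open window `547 543 ≤ r ≤ 1 032 613`, memo HOME/val-np-p6/g17/MEMO-valnp6-g17.md §3).
The second-shell immobile-token cell for every `h` is the sibling `…SecondShellAnyHCells`.

HONEST LABEL: cells of the conjecture column at the ball sizes `r = |B_t(h)|`; 19717 stays OPEN; nothing on crux 14610 or VP ≠ VNP.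
-/

set_option linter.dupNamespace false

namespace Summit.ValiantsHypothesis.ValiantsHypothesis.Theorems.BarrierLever.HiddenStates

open Finset

noncomputable section

namespace SecondShell

open PathTable

/-- a four-part re-indexing with free fourth size: `(Fin (k+1) ⊕ Fin k) ⊕ (Fin j ⊕ Fin j') ≃ α` onto `C ∖ A`, `A ∖ C`, `A ∩ C`, `(A ∪ C)ᶜ`. -/
theorem exists_equiv_four' {α : Type} [Fintype α] [DecidableEq α] (A C : Finset α) {k j j' : ℕ}
    (h1 : (C \ A).card = k + 1) (h2 : (A \ C).card = k) (h3 : (A ∩ C).card = j) (h4 : (A ∪ C)ᶜ.card = j') :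
    ∃ e : (Fin (k + 1) ⊕ Fin k) ⊕ (Fin j ⊕ Fin j') ≃ α,
      (∀ b, e (Sum.inl (Sum.inl b)) ∈ C \ A) ∧ (∀ i, e (Sum.inl (Sum.inr i)) ∈ A \ C) ∧
      (∀ z, e (Sum.inr (Sum.inl z)) ∈ A ∩ C) ∧ (∀ w, e (Sum.inr (Sum.inr w)) ∈ (A ∪ C)ᶜ) := by
  classical
  let e1 := ((C \ A).equivFinOfCardEq h1).symm
  let e2 := ((A \ C).equivFinOfCardEq h2).symm
  let e3 := ((A ∩ C).equivFinOfCardEq h3).symm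
  let e4 := ((A ∪ C)ᶜ.equivFinOfCardEq h4).symm
  let f : (Fin (k + 1) ⊕ Fin k) ⊕ (Fin j ⊕ Fin j') → α :=
    fun x => Sum.elim (Sum.elim (fun b => (e1 b).1) (fun i => (e2 i).1)) (Sum.elim (fun z => (e3 z).1) (fun w => (e4 w).1)) x
  have m1 : ∀ b, f (Sum.inl (Sum.inl b)) ∈ C \ A := fun b => (e1 b).2
  have m2 : ∀ i, f (Sum.inl (Sum.inr i)) ∈ A \ C := fun i => (e2 i).2
  have m3 : ∀ z, f (Sum.inr (Sum.inl z)) ∈ A ∩ C := fun z => (e3 z).2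
  have m4 : ∀ w, f (Sum.inr (Sum.inr w)) ∈ (A ∪ C)ᶜ := fun w => (e4 w).2
  have hinj : Function.Injective f := by
    intro x y hxy
    rcases x with (b | i) | (z | w) <;> rcases y with (b' | i') | (z' | w')
    all_goals first
      | (have hx := m1 b; have hy := m1 b') | (have hx := m1 b; have hy := m2 i') | (have hx := m1 b; have hy := m3 z')
      | (have hx := m1 b; have hy := m4 w')
      | (have hx := m2 i; have hy := m1 b') | (have hx := m2 i; have hy := m2 i') | (have hx := m2 i; have hy := m3 z')
      | (have hx := m2 i; have hy := m4 w')
      | (have hx := m3 z; have hy := m1 b') | (have hx := m3 z; have hy := m2 i') | (have hx := m3 z; have hy := m3 z')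
      | (have hx := m3 z; have hy := m4 w')
      | (have hx := m4 w; have hy := m1 b') | (have hx := m4 w; have hy := m2 i') | (have hx := m4 w; have hy := m3 z')
      | (have hx := m4 w; have hy := m4 w')
    all_goals rw [hxy] at hx
    all_goals simp only [Finset.mem_sdiff, Finset.mem_inter, Finset.mem_compl, Finset.mem_union, not_or] at hx hy
    · exact congrArg _ (congrArg _ (e1.injective (Subtype.ext hxy)))
    all_goals first | tauto | skip
    · exact congrArg _ (congrArg _ (e2.injective (Subtype.ext hxy)))
    · exact congrArg _ (congrArg _ (e3.injective (Subtype.ext hxy)))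
    · exact congrArg _ (congrArg _ (e4.injective (Subtype.ext hxy)))
  have hcard : Fintype.card ((Fin (k + 1) ⊕ Fin k) ⊕ (Fin j ⊕ Fin j')) = Fintype.card α := by
    simp only [Fintype.card_sum, Fintype.card_fin]
    have hCA : (C \ A).card + (A ∩ C).card = C.card := by
      rw [Finset.inter_comm]; exact Finset.card_sdiff_add_card_inter C A
    have hAC : (A \ C).card + (A ∩ C).card = A.card := Finset.card_sdiff_add_card_inter A C
    have hU : (A ∪ C).card + (A ∩ C).card = A.card + C.card := Finset.card_union_add_card_inter A C
    have hc : (A ∪ C)ᶜ.card = Fintype.card α - (A ∪ C).card := Finset.card_compl _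
    have hle : (A ∪ C).card ≤ Fintype.card α := Finset.card_le_univ _
    omega
  have hbij : Function.Bijective f := (Fintype.bijective_iff_injective_and_card f).2 ⟨hinj, hcard⟩
  exact ⟨Equiv.ofBijective f hbij, m1, m2, m3, m4⟩

/-- the first-shell table on the abstract index type with inert blocks of sizes `j, j'`. -/
def coreTable' (k j j' : ℕ) :
    (Fin (k + 1) ⊕ Fin k) ⊕ (Fin j ⊕ Fin j') → (Fin (k + 1) ⊕ Fin k) ⊕ (Fin j ⊕ Fin j') → ℂ
  | Sum.inl a₁, Sum.inl q₁ => pw k 1 a₁ q₁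
  | Sum.inl _, Sum.inr _ => 0
  | Sum.inr z, q => if q = Sum.inr z then 1 else 0

/-- the table transported along `e`. -/
def swapTable' {α : Type} {k j j' : ℕ} (e : (Fin (k + 1) ⊕ Fin k) ⊕ (Fin j ⊕ Fin j') ≃ α) : α → α → ℂ :=
  fun a q => coreTable' k j j' (e.symm a) (e.symm q)

variable {α : Type} [Fintype α] [DecidableEq α]

/-- the row of an X-element of the core is a unit vector. -/
theorem coreTable'_inr_row (k j j' : ℕ) (i : Fin k) (q : (Fin (k + 1) ⊕ Fin k) ⊕ (Fin j ⊕ Fin j')) :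
    coreTable' k j j' (Sum.inl (Sum.inr i)) q = if q = Sum.inl (Sum.inr i) then 1 else 0 := by
  rcases q with (b | i') | z
  · simp [coreTable', pw]
  · by_cases h : i' = i
    · subst h; simp [coreTable', pw]
    · simp [coreTable', pw, h]
  · simp [coreTable']

omit [Fintype α] in
/-- **off-diagonal support**: a nonzero off-diagonal entry `swapTable' e a q` has its row `a` in `C ∖ A`. -/
theorem swapTable'_offdiag {k j j' : ℕ} (A C : Finset α) (e : (Fin (k + 1) ⊕ Fin k) ⊕ (Fin j ⊕ Fin j') ≃ α)
    (m1 : ∀ b, e (Sum.inl (Sum.inl b)) ∈ C \ A) {a q : α} (h : swapTable' e a q ≠ 0) (hne : q ≠ a) : a ∈ C \ A := by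
  unfold swapTable' at h
  have hqa : e.symm q ≠ e.symm a := fun h' => hne (e.symm.injective h')
  rcases hx : e.symm a with (b | i) | z
  · have : a = e (Sum.inl (Sum.inl b)) := by rw [← hx, Equiv.apply_symm_apply]
    rw [this]; exact m1 b
  · exfalso; apply h
    rw [hx, coreTable'_inr_row, if_neg (hx ▸ hqa)]
  · exfalso; apply h
    have : coreTable' k j j' (Sum.inr z) (e.symm q) = if e.symm q = Sum.inr z then 1 else 0 := by simp [coreTable']
    rw [hx, this, if_neg (hx ▸ hqa)]

/-- ★ **The first-shell certificate with a prescribed transport, inert blocks of any sizes.** -/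
theorem swapTable'_det_ne_zero {k j j' : ℕ} (hk : 1 ≤ k) (A C : Finset α)
    (e : (Fin (k + 1) ⊕ Fin k) ⊕ (Fin j ⊕ Fin j') ≃ α)
    (m1 : ∀ b, e (Sum.inl (Sum.inl b)) ∈ C \ A) (m2 : ∀ i, e (Sum.inl (Sum.inr i)) ∈ A \ C)
    (m3 : ∀ z, e (Sum.inr (Sum.inl z)) ∈ A ∩ C) (m4 : ∀ w, e (Sum.inr (Sum.inr w)) ∈ (A ∪ C)ᶜ)
    {r : ℕ} (v cols : Fin r → Finset α) (hv : Function.Injective v)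
    (hV : ∀ i, ((v i).card ≤ k + j ∧ v i ≠ A) ∨ v i = C)
    (hcols : ∀ J : Finset α, J.card ≤ k + j → ∃ kk, cols kk = J) :
    (mat (swapTable' e) v cols).det ≠ 0 := by
  classical
  let Z : Finset (Fin j ⊕ Fin j') := (Finset.univ : Finset (Fin j)).image Sum.inl
  have hZ : Z.card = j := by
    simp only [Z]; rw [Finset.card_image_of_injective _ Sum.inl_injective, Finset.card_univ, Fintype.card_fin]
  let rowS : Fin r → Finset ((Fin (k + 1) ⊕ Fin k) ⊕ (Fin j ⊕ Fin j')) := fun i => (v i).map e.symm.toEmbedding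
  let colJ : Fin r → Finset ((Fin (k + 1) ⊕ Fin k) ⊕ (Fin j ⊕ Fin j')) := fun kk => (cols kk).map e.symm.toEmbedding
  have hmem : ∀ x, (e x ∈ A ↔ x ∈ ((Finset.univ : Finset (Fin k)).image Sum.inr).disjSum Z) ∧
      (e x ∈ C ↔ x ∈ ((Finset.univ : Finset (Fin (k + 1))).image Sum.inl).disjSum Z) := by
    intro x
    rcases x with (b | i) | (z | w')
    · have h := m1 b; rw [Finset.mem_sdiff] at h
      simp [Z, h.1, h.2]
    · have h := m2 i; rw [Finset.mem_sdiff] at h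
      simp [Z, h.1, h.2]
    · have h := m3 z; rw [Finset.mem_inter] at h
      simp [Z, h.1, h.2]
    · have h := m4 w'; rw [Finset.mem_compl, Finset.mem_union, not_or] at h
      simp [Z, h.1, h.2]
  have hmapA : A.map e.symm.toEmbedding = ((Finset.univ : Finset (Fin k)).image Sum.inr).disjSum Z := by
    ext x; rw [Finset.mem_map_equiv, Equiv.symm_symm]; exact (hmem x).1
  have hmapC : C.map e.symm.toEmbedding = ((Finset.univ : Finset (Fin (k + 1))).image Sum.inl).disjSum Z := by
    ext x; rw [Finset.mem_map_equiv, Equiv.symm_symm]; exact (hmem x).2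
  have hinj : Function.Injective rowS := fun i i' hij => hv (Finset.map_injective _ hij)
  have hrow : ∀ i, ((rowS i).card ≤ k + Z.card ∧ rowS i ≠ ((Finset.univ : Finset (Fin k)).image Sum.inr).disjSum Z) ∨
      rowS i = ((Finset.univ : Finset (Fin (k + 1))).image Sum.inl).disjSum Z := by
    intro i
    rcases hV i with ⟨hc, hne⟩ | h
    · left
      refine ⟨by simp only [rowS, Finset.card_map, hZ]; omega, fun h => hne ?_⟩
      rw [← hmapA] at h
      exact Finset.map_injective _ h
    · right; simp only [rowS, h, hmapC]
  have hcol : ∀ J : Finset ((Fin (k + 1) ⊕ Fin k) ⊕ (Fin j ⊕ Fin j')), J.card ≤ k + Z.card → ∃ kk, colJ kk = J := by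
    intro J hJ
    obtain ⟨kk, hkk⟩ := hcols (J.map e.toEmbedding) (by rw [Finset.card_map]; omega)
    refine ⟨kk, ?_⟩
    simp only [colJ, hkk, Finset.map_map]
    convert Finset.map_refl (s := J)
    ext x; simp
  have hdet := det_ne_zero_of_dual_inert (pw k 1) (ppot k) (pw_ne_zero k 1) (pw_self k 1) k
    ((Finset.univ : Finset (Fin k)).image Sum.inr) ((Finset.univ : Finset (Fin (k + 1))).image Sum.inl) (zk k 1)
    (fun R hR => zk_card_ne (by omega)) (fun S hS hX => lambda_row_eq_zero S hS hX) (lambda_Y_ne_zero' hk one_ne_zero)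
    Z (coreTable' k j j') (fun _ _ => rfl) (fun _ _ => rfl) (fun _ _ => rfl) rowS colJ hinj hrow hcol
  convert hdet using 2
  ext i kk
  simp only [mat, Matrix.of_apply, rowS, colJ, Finset.prod_map, Finset.sum_map]
  rfl

/-- the sizes of a first-shell swap in `Fin h`: `k = |A ∖ C| ≥ 1`, `j = |A ∩ C|`, `j' = |(A ∪ C)ᶜ|`. -/
theorem swap_sizes {h t : ℕ} (A C : Finset (Fin h)) (hA : A.card = t) (hC : C.card = t + 1) (hAC : ¬ A ⊆ C) :
    ∃ k j j', 1 ≤ k ∧ k + j = t ∧ (C \ A).card = k + 1 ∧ (A \ C).card = k ∧ (A ∩ C).card = j ∧ (A ∪ C)ᶜ.card = j' := by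
  refine ⟨t - (A ∩ C).card, (A ∩ C).card, (A ∪ C)ᶜ.card, ?_, ?_, ?_, ?_, rfl, rfl⟩
  · have hlt : (A ∩ C).card < A.card := by
      refine Finset.card_lt_card ⟨Finset.inter_subset_left, fun h' => hAC ?_⟩
      exact fun x hx => (Finset.mem_inter.1 (h' hx)).2
    omega
  · have := Finset.card_le_card (Finset.inter_subset_left : A ∩ C ⊆ A); omega
  · have := Finset.card_sdiff_add_card_inter C A; rw [Finset.inter_comm] at this
    have h' := Finset.card_le_card (Finset.inter_subset_left : A ∩ C ⊆ A); omega
  · have := Finset.card_sdiff_add_card_inter A C; omega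

/-- ★★ **THE FIRST SHELL OF EVERY BALL**: for all `h, t` and `A, C ⊆ Fin h` with `|A| = t`, `|C| = t + 1`, `A ⊄ C`, every injective row
family ranging in `B_t(h) ∖ {A} ∪ {C}` whose columns cover `B_t(h)` is served by a table. -/
theorem exists_table_firstShell_anyH (h t : ℕ) (A C : Finset (Fin h)) (hA : A.card = t) (hC : C.card = t + 1) (hAC : ¬ A ⊆ C)
    {r : ℕ} (u cols : Fin r → Finset (Fin h)) (hu : Function.Injective u)
    (hU : ∀ i, ((u i).card ≤ t ∧ u i ≠ A) ∨ u i = C)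
    (hcols : ∀ J : Finset (Fin h), J.card ≤ t → ∃ kk, cols kk = J) :
    ∃ tx : Option (Fin h) → Fin h → ℂ,
      (Matrix.of fun i kk : Fin r => ∏ a ∈ u i, (tx none a + ∑ q ∈ cols kk, tx (some q) a)).det ≠ 0 := by
  classical
  obtain ⟨k, j, j', hk, hkj, a1, a2, a3, a4⟩ := swap_sizes A C hA hC hAC
  obtain ⟨e, m1, m2, m3, m4⟩ := exists_equiv_four' A C a1 a2 a3 a4
  have hdet := swapTable'_det_ne_zero hk A C e m1 m2 m3 m4 u cols hu (by rw [hkj]; exact hU) (by rw [hkj]; exact hcols)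
  refine ⟨fun o a => match o with | none => 0 | some q => swapTable' e a q, ?_⟩
  simpa [mat, zero_add] using hdet

end SecondShell

end

end Summit.ValiantsHypothesis.ValiantsHypothesis.Theorems.BarrierLever.HiddenStates
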